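import Summits.QuantumFields.YangMills.Theorems.BalabanUVNodesN12CouplingStepOfBetaSign
import Literature.MathematicalPhysics.QuantumFieldTheory.Balaban1983to89.B15Claim189ZppOfRecordPin

/-!
# BalabanUVNodes ∕ N12 — N12's MOST-PINNED ROW AT THE `Z″`-OF-RECORD ∕ SIDE ∕ `χ(Ω^{∼4})` ∕ `Ω″`-PINNED STACK (dag-n12-e modules 17–19: `Sit189.pinSides`, `pinXΩ4`, `pinOmegaPP`,
# `pinZres` — «the only residual REGION letter of the (1.89) situation is the component union `Z`»): 12N's window-keyed `Λ`-row at the per-run situation family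
# `σᶻ P := ((((σ P).pinZres …).pinSides …).pinXΩ4 …).pinOmegaPP …`, the cube-side sign `0 < sh` DISCHARGED from `0 < M₂`; generic live re-pin, `θ₁₅ᶜ`, `θ₁₅ᶜᶜ¹`; BACKGROUND-FREE
# (Track A, DAG node N12 = [B15, Balaban1989LargeFieldI] CMP **122** (1989) 175–202; cluster K1 (K1⁗ stmt-QuantumFields-20290 → K1⁵ at rev 20 on v1.4 `SepCo`); seat `pub-ymgap-dag-n12-d` g9 (R134
# s2 «knit at the record»), 2026-08-27; count-neutral, NOT a discharge)

HONEST FRAMING.  Count-neutral kernel INSTANTIATION BY NAME: 12N's ★★ `b15Leaf_WOfRecord₁₃_pinAllΛ_N0_liveRepin₁₃_of_massLive_of_hasResiduals_of_flow_of_betaLowerH` (generic in the per-run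
situation family `σ`) AT dag-n12-e's fully pinned family `σᶻ` — module 19 `Sit189.pinZres` (the interpolated `Z″_j` := lit-balaban p29's torus regions of record `ZppT`), module 17 `pinSides`
(the cube sides := def-R's `LM₂R_j`-sides of record), module 18 `pinXΩ4` (the `χ_k(Ω_k^{∼4})` cube family of record), module 17 `pinOmegaPP` (`Ω″` over the enlargement of record) — under
which module 16's `Λ`-layer `ResidW.pinD189ΛH` builds the rest of the stack (`pinLambda → pinDistAt → pinZpp → pinCubes → sitOfHist`), i.e. EXACTLY the letters `D` of module 19's ★★★
`claim189_sitOfHist_ΛΩχZ_of_flow` (dag-n12-e FYI l.≈18050: «`σT P := (σ P).pinZres …` innermost gives your rows the `Z″` of record»).  Every pin is a structure update, so the displayed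
residual NUMBERS (`β, L₀, δ, B₃, B₅, O(1)`) and `Z` are read at the closer's base family `σ P` (`rfl`); the cube-side sign `0 < (σᶻ P).sh` is module 17's `cubeSide_pos` from `0 < M₂`.  Nothing
of Bałaban's is asserted; the displays of 12N stand verbatim otherwise; N12 is NOT discharged; counts unmoved (Track A discharged 5∕28).  ONE finite four-torus programme at fixed `ε = L^{-K}` —
nothing continuum ∕ ℝ⁴ ∕ OS ∕ mass gap ∕ Clay.

WHAT THIS FILE GIVES (all count-neutral, BACKGROUND-FREE — survives the (β) re-base of RECORD 13 untouched):
* §1 ★★ `b15Leaf_WOfRecord₁₃_pinAllΛΩχZ_N0_liveRepin₁₃_of_massLive_of_hasResiduals_of_flow_of_betaLowerH` (generic `Θ` with K0b's residuals; 12N §1's list with `hsh` REPLACED by `hM₂ : 0 < Θ.ν.M₂`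
  and the situation letters `sh, sk, XΩ4, OmT, ΩppT2, Zpp` no longer residual).
* §2 ★★★ at `θ₁₅ᶜ` and at `θ₁₅ᶜᶜ¹` (`M₂ = 1`, `M = 1` of record discharge `hM₂`, `0 < M`): THE KERNEL's LIST OF WHAT N12 COSTS PER RUN AT THE PLAN's WITNESSES WITH EVERY REGION LETTER OF THE (1.89)
  SITUATION EXCEPT `Z` AN OBJECT OF RECORD: live-mass at level `kSel P + 1` (NODE 00) · Prop. 1 at `λ.LF P` · levels `hlog ∕ hNN ∕ hNk` · the base situation's residual NUMBERS `β, L₀, δ, B₃, B₅,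
  O(1)` + print's two p. 200 conditions · the (2.8a) relation `hflow` · `Λ ≠ ∅` (`hΛ`, read at `(σ P).Z`) · the four ℍ-leaves + (1.80) at the letters `D` · the run's window + β-sign leaf + weak signs.

Sources: [Balaban1989LargeFieldI] (0.2)–(0.6) p.176, (1.2) p.178, (1.10)–(1.11) p.179, (1.73) p.192, Prop. 1 (1.78) p.194, (1.80) p.195, (1.88)–(1.90) pp.197–198, (1.99)–(1.102) pp.200–201;
[Balaban1988Convergent] (2.1) p.254, (2.13) p.256, (2.17) p.257, (3.16)–(3.25) pp.268–270; [Balaban1987RG1] (0.20) p.256; [Balaban1985Variational] Thm 1 p.279 (witness letters only).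
-/

noncomputable section

open MeasureTheory
open scoped Matrix.Norms.L2Operator

namespace Summit.QuantumFields.YangMills.BalabanUVNodes.N12AtRecord13TermPinnedZres

open Literature.MathematicalPhysics.QuantumFieldTheory.Balaban1983to89
open Literature.MathematicalPhysics.QuantumFieldTheory.Balaban1983to89.T4Continuum (T4Family)
open Literature.MathematicalPhysics.QuantumFieldTheory.Balaban1983to89.DagBinding (PrintedCarriers15 B15Leaf)
open Literature.MathematicalPhysics.QuantumFieldTheory.Balaban1983to89.Node00
open B15Claim189Assembly (Setting189 new189 chiPP dom half)
open B15 (Prop1Printed Ineq180)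
open B15.BasicStep (Claim189)
open B15.PrelimIntegrations (Ineq191 Ineq195)
open B15Chi124DetSets (E124)
open B15DeterminingSets (MSField)
open B14DomainGeom (Pt)
open B8Eq17ClassAkV1 (plaqsOf)
open GaugeGroup (dist1)
open GaugeField (plaqHol)
open B15Claim189PrintedConditions (omegaOfChain)
open B15Claim189PinsOfHistory (sitOfHist N0OfRecord₁₃ D189OfHist)
open B15Claim189LambdaPin (enlD)
open B15Claim189OmegaPPPin (cubeSide_pos)
open FlowStep (BetaLowerH)
open Summit.QuantumFields.YangMills.BalabanUVNodes.N12CouplingStepOfBetaSign (b15Leaf_WOfRecord₁₃_pinAllΛ_N0_liveRepin₁₃_of_massLive_of_hasResiduals_of_flow_of_betaLowerH)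

variable {N : ℕ} [NeZero N] {F : T4Family}

/-! ## §1 GENERIC `Θ` CARRYING K0b's RESIDUALS — the `Λ`-layer at the `Z″`-of-record ∕ side ∕ χ ∕ `Ω″`-pinned situation family -/

section Leaf
variable (Θ : Stage13Params F N) (lam : ResidW F N) (σ : ∀ P : B12.RunParams, Sit189 F N P.K)
  (s : ∀ P : B12.RunParams, SeqOfRecord F Θ.ν Θ.τ9.M (gOfRecord₁₃ F N (Θ.liveRepin₁₃ F N) P) P.K (lam.kSel P + 1)) (Nm : B12.RunParams → ℕ) (p₁ : ℕ)

/-- **★★ 12N's WINDOW-KEYED `Λ`-ROW AT THE `Z″`-OF-RECORD ∕ SIDE ∕ `χ(Ω^{∼4})` ∕ `Ω″`-PINNED SITUATION FAMILY** `σᶻ P := ((((σ P).pinZres Θ.ν Θ.τ9.M g (s P) (N₀ P)).pinSides Θ.ν g (k′ − N P) k′).pinXΩ4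
(s P) enlD).pinOmegaPP (s P) (N P) enlD` (`k′ = kSel P + 1`, `g` the run's ₁₃ history at the live re-pin, `N₀ P := N0OfRecord₁₃ θL P k′`): the letters of module 19's ★★★ display; `0 < sh`
from `0 < M₂` (module 17 `cubeSide_pos`); the residual numbers and `Z` read at the base family `σ P`. [cite: Balaban1989LargeFieldI, (0.2)–(0.6) p.176, (1.2) p.178, (1.10)–(1.11) p.179, (1.73) p.192, Prop. 1 (1.78) p.194, (1.80) p.195, (1.89) p.198, pp.199–201; Balaban1988Convergent, (2.1) p.254, (2.17) p.257, (3.16) p.268, (3.22)–(3.25) pp.269–270; Balaban1987RG1, (0.20) p.256] -/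
theorem b15Leaf_WOfRecord₁₃_pinAllΛΩχZ_N0_liveRepin₁₃_of_massLive_of_hasResiduals_of_flow_of_betaLowerH (hres : Θ.HasResidualsOfRecord F N)
    {P : B12.RunParams} (hK : lam.kSel P < P.K) (hM₂ : 0 < Θ.ν.M₂) (hM : 0 < Θ.τ9.M)
    {D : Setting189 (F.P P.K) (SU N) (MSField (F.P P.K) (SU N) × ((j : ℕ) → VecField (F.P P.K) j (EuclideanSpace ℝ (Fin (N ^ 2 - 1))))) (Pt (F.P P.K).d)}
    (hD : D = ((lam.pinRPrime₁₃ (Θ.liveRepin₁₃ F N)).pinD189ΛH (Θ.liveRepin₁₃ F N).ν (Θ.liveRepin₁₃ F N).A₁ (Θ.liveRepin₁₃ F N).τ9.M (gOfRecord₁₃ F N (Θ.liveRepin₁₃ F N)) (fun P => (((((σ P).pinZres Θ.ν Θ.τ9.M (gOfRecord₁₃ F N (Θ.liveRepin₁₃ F N) P) (s P) (N0OfRecord₁₃ (Θ.liveRepin₁₃ F N) P (lam.kSel P + 1))).pinSides Θ.ν (gOfRecord₁₃ F N (Θ.liveRepin₁₃ F N) P) (lam.kSel P + 1 - Nm P)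 (lam.kSel P + 1)).pinXΩ4 (s P) (enlD F Θ.ν Θ.τ9.M P (gOfRecord₁₃ F N (Θ.liveRepin₁₃ F N) P))).pinOmegaPP (s P) (Nm P) (enlD F Θ.ν Θ.τ9.M P (gOfRecord₁₃ F N (Θ.liveRepin₁₃ F N) P)))) s Nm p₁).D189 P)
    (hmassLive : ∀ a, LiveSeq F N Θ.ν Θ.τ9 P (gOfRecord₁₃ F N (Θ.liveRepin₁₃ F N) P) (lam.kSel P + 1)
        (slotsTOfRecord F N Θ.ν Θ.τ9 (EOfRecord₁₃ F N (Θ.liveRepin₁₃ F N)) (wOfRecord₉ F N (Θ.liveRepin₁₃ F N).toStage9Params)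
          (Θ.liveRepin₁₃ F N).ppSel P (gOfRecord₁₃ F N (Θ.liveRepin₁₃ F N) P) (lam.kSel P + 1)) a →
      0 < ∫ V, rterm (reprTOfRecord₁₃ F N (Θ.liveRepin₁₃ F N) P (lam.kSel P)) a V ∂(fieldMeasure (F.P P.K) (lam.kSel P + 1) (SU N)))
    (hP1 : Prop1Printed (lam.LF P))
    (hlog : 1 < (Real.log (gOfRecord₁₃ F N (Θ.liveRepin₁₃ F N) P (lam.kSel P + 1) ^ 2)⁻¹) ^ Θ.ν.r)
    (hNN : N0OfRecord₁₃ (Θ.liveRepin₁₃ F N) P (lam.kSel P + 1) ≤ Nm P) (hNk : N0OfRecord₁₃ (Θ.liveRepin₁₃ F N) P (lam.kSel P + 1) ≤ lam.kSel P + 1)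
    (hβ0 : 0 ≤ (σ P).β) (hβ : (σ P).β ≤ 1 / 4) (hL₀ : 2 ≤ (σ P).L₀) (hL₀L : (σ P).L₀ ^ 2 ≤ ((F.P P.K).L : ℝ))
    (hB : 0 ≤ (σ P).O1 * (σ P).B₃ * (σ P).B₅) (hδ : 0 ≤ (σ P).δ)
    (hN₀ : (2 + (121 / 120) ^ 2 * ((σ P).O1 * (σ P).B₃ * (σ P).B₅ * (Θ.τ9.M : ℝ) ^ 5)) *
      ((((σ P).L₀ ^ 2) ^ (N0OfRecord₁₃ (Θ.liveRepin₁₃ F N) P (lam.kSel P + 1) - 1))⁻¹) ≤ 1 / 4)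
    (hMl : (121 / 120) ^ 2 * ((σ P).O1 * (σ P).B₃ * (σ P).B₅ * (Θ.τ9.M : ℝ) ^ 5) * Real.exp (-(4 * (σ P).δ * (Θ.τ9.M : ℝ))) ≤ 1 / 12)
    (hε0 : ∀ i, lam.kSel P + 1 - Nm P ≤ i → i ≤ lam.kSel P + 1 → 0 ≤ epsOfRecord Θ.ν (gOfRecord₁₃ F N (Θ.liveRepin₁₃ F N) P) i)
    (hε1 : ∀ i, lam.kSel P + 1 - Nm P ≤ i → i ≤ lam.kSel P + 1 → epsOfRecord Θ.ν (gOfRecord₁₃ F N (Θ.liveRepin₁₃ F N) P) i ≤ 1 / 10)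
    {β₀ : ℝ} (hβ₀0 : 0 ≤ β₀) (hβ₀ : β₀ ≤ 1 / 2)
    (hflow : ∀ j, lam.kSel P + 1 - Nm P ≤ j → j < lam.kSel P + 1 → epsOfRecord Θ.ν (gOfRecord₁₃ F N (Θ.liveRepin₁₃ F N) P) (lam.kSel P + 1)
      ≤ (1 + β₀) * Real.sqrt ((lam.kSel P + 1 - j : ℕ) : ℝ) * epsOfRecord Θ.ν (gOfRecord₁₃ F N (Θ.liveRepin₁₃ F N) P) j)
    -- NEW (this file): the window of the run up to the torus and the β-sign leaf on the window box REPLACE the coupling-step displays `hgpos hgstep hgle`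
    {b γ : ℝ} (hb : 0 ≤ b) (hlow : BetaLowerH b γ (betaOfRecord₁₃ F N (Θ.liveRepin₁₃ F N))) (hγ1 : γ ≤ 1)
    (hI : Step.InInterval γ P.K (gOfRecord₁₃ F N (Θ.liveRepin₁₃ F N) P))
    (hΛ : (((enlD F Θ.ν Θ.τ9.M P (gOfRecord₁₃ F N (Θ.liveRepin₁₃ F N) P)) 4 (lam.kSel P + 1 + 1 - (N0OfRecord₁₃ (Θ.liveRepin₁₃ F N) P (lam.kSel P + 1)))
        (omegaOfChain (s P) (lam.kSel P + 1 + 1 - (N0OfRecord₁₃ (Θ.liveRepin₁₃ F N) P (lam.kSel P + 1)))))ᶜ ∩ (σ P).Z).Nonempty)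
    (L91h : ∀ U, new189 D U → ∀ p ∈ plaqsOf (half D),
      Ineq191 (dist1 (plaqHol (D.Upp U) p)) (D.devV'' U p) D.α ((D.L ^ D.h)⁻¹) (D.ε D.h) (E124 D.ε D.L D.η D.k D.h))
    (L95 : ∀ U, new189 D U → ∀ p ∈ plaqsOf (half D),
      Ineq195 (D.devV'' U p) (dist1 (plaqHol (D.Uhalf U (D.boxOf p)) p)) D.α ((D.L ^ D.h)⁻¹) (D.ε D.h) (E124 D.ε D.L D.η D.k D.h))
    (L91 : ∀ U, new189 D U → ∀ j, D.h ≤ j → j ≤ D.k → ∀ p ∈ plaqsOf (dom D j),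
      Ineq191 (dist1 (plaqHol (D.Upp U) p)) (D.dev97 U p) D.α ((D.L ^ j)⁻¹) (D.ε j) (E124 D.ε D.L D.η D.k j))
    (L97 : ∀ U, new189 D U → ∀ j, D.h ≤ j → j ≤ D.k → ∀ p ∈ plaqsOf (dom D j),
      Ineq191 (D.dev97 U p) (D.dev0 U p) D.α ((D.L ^ j)⁻¹) (D.ε j) (E124 D.ε D.L D.η D.k j))
    (L80 : ∀ U, new189 D U → ∀ j, D.h ≤ j → j ≤ D.k → ∀ p ∈ plaqsOf (dom D j),
      Ineq180 (D.dev0 U p) (D.ε D.k) D.η D.B₃ D.B₅ D.M D.δ (D.dist p) D.O1) :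
    B15Leaf (WOfRecord₁₃ F N (Θ.liveRepin₁₃ F N)
      ((lam.pinRPrime₁₃ (Θ.liveRepin₁₃ F N)).pinD189ΛH (Θ.liveRepin₁₃ F N).ν (Θ.liveRepin₁₃ F N).A₁ (Θ.liveRepin₁₃ F N).τ9.M (gOfRecord₁₃ F N (Θ.liveRepin₁₃ F N))
        (fun P => (((((σ P).pinZres Θ.ν Θ.τ9.M (gOfRecord₁₃ F N (Θ.liveRepin₁₃ F N) P) (s P) (N0OfRecord₁₃ (Θ.liveRepin₁₃ F N) P (lam.kSel P + 1))).pinSides Θ.ν (gOfRecord₁₃ F N (Θ.liveRepin₁₃ F N) P) (lam.kSel P + 1 - Nm P) (lam.kSel P + 1)).pinXΩ4 (s P) (enlD F Θ.ν Θ.τ9.M P (gOfRecord₁₃ F N (Θ.liveRepin₁₃ F N) P))).pinOmegaPP (s P) (Nm P) (enlD F Θ.ν Θ.τ9.M P (gOfRecord₁₃ F N (Θ.liveRepin₁₃ F N) P)))) s Nm p₁) P) :=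
  -- `0 < sh` at the side-pinned stack: dag-n12-e module 17's `pinSides_sh_pos` ∕ `cubeSide_pos` from `0 < M₂` (the `LM₂R_h`-cubes of record have positive side)
  b15Leaf_WOfRecord₁₃_pinAllΛ_N0_liveRepin₁₃_of_massLive_of_hasResiduals_of_flow_of_betaLowerH Θ lam
    (fun P => (((((σ P).pinZres Θ.ν Θ.τ9.M (gOfRecord₁₃ F N (Θ.liveRepin₁₃ F N) P) (s P) (N0OfRecord₁₃ (Θ.liveRepin₁₃ F N) P (lam.kSel P + 1))).pinSides Θ.ν (gOfRecord₁₃ F N (Θ.liveRepin₁₃ F N) P) (lam.kSel P + 1 - Nm P) (lam.kSel P + 1)).pinXΩ4 (s P) (enlD F Θ.ν Θ.τ9.M P (gOfRecord₁₃ F N (Θ.liveRepin₁₃ F N) P))).pinOmegaPP (s P) (Nm P) (enlD F Θ.ν Θ.τ9.M P (gOfRecord₁₃ F N (Θ.liveRepin₁₃ F N) P)))) s Nm p₁ hres hK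
    (cubeSide_pos (F.P P.K).L_pos hM₂ _ _ _) hM hD hmassLive hP1 hlog hNN hNk hβ0 hβ hL₀ hL₀L hB hδ hN₀ hMl hε0 hε1 hβ₀0 hβ₀ hflow hb hlow hγ1 hI hΛ L91h L95 L91 L97 L80

end Leaf

/-! ## §2 AT `θ₁₅ᶜ` AND AT `θ₁₅ᶜᶜ¹` — N12's rows with every region letter of (1.89) except `Z` an object of record -/

section Thm1CZ
variable (ε₀ ε₂₉ B₃ a₀ a₁ : ℝ) (lam : ResidW F N) (σ : ∀ P : B12.RunParams, Sit189 F N P.K)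
  (s : ∀ P : B12.RunParams, SeqOfRecord F (theta13OfThm1C F N ε₀ ε₂₉ B₃ a₀ a₁).ν (theta13OfThm1C F N ε₀ ε₂₉ B₃ a₀ a₁).τ9.M
    (gOfRecord₁₃ F N (theta13OfThm1C F N ε₀ ε₂₉ B₃ a₀ a₁) P) P.K (lam.kSel P + 1)) (Nm : B12.RunParams → ℕ) (p₁ : ℕ)

/-- **★★★ N12's ROW AT `θ₁₅ᶜ` WITH EVERY REGION LETTER OF THE (1.89) SITUATION EXCEPT `Z` AN OBJECT OF RECORD** (12N §2's `θ₁₅ᶜ` row at the pinned situation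
family `σᶻ`; `M₂ = 1` of record discharges the cube-side sign, `M = 1` gives `0 < M`; the coupling step and the flow-input signs∕sizes from the window as in 12N §2): the kernel's list of what N12 costs per run
at this witness — live-mass, Prop. 1 at `λ.LF P`, the levels, the base situation's residual NUMBERS + print's two p. 200 conditions, (2.8a) `hflow`, `Λ ≠ ∅`, the four ℍ-leaves + (1.80) at `D`,
the run's window + β-sign leaf + the witness letters' weak signs. [cite: Balaban1989LargeFieldI, (0.2)–(0.6) p.176, (1.2) p.178, (1.10)–(1.11) p.179, (1.73) p.192, Prop. 1 (1.78) p.194, (1.80) p.195, (1.89) p.198, pp.199–201; Balaban1988Convergent, (2.1)–(2.8) pp.254–256, (2.17) p.257; Balaban1987RG1, (0.20) p.256; Balaban1985Variational, Thm 1 p.279 (witness letters only)] -/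
theorem b15Leaf_WOfRecord₁₃_pinAllΛΩχZ_N0_theta13OfThm1C_of_massLive_of_flow_of_betaLowerH
    (hB₃ : 0 ≤ B₃) (ha₀ : 0 ≤ a₀) (ha₁ : 0 ≤ a₁) -- the witness letters' weak signs (for `0 ≤ A₀ᶜ ≤ 1∕16`)
    {P : B12.RunParams} (hK : lam.kSel P < P.K) 
    {D : Setting189 (F.P P.K) (SU N) (MSField (F.P P.K) (SU N) × ((j : ℕ) → VecField (F.P P.K) j (EuclideanSpace ℝ (Fin (N ^ 2 - 1))))) (Pt (F.P P.K).d)}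
    (hD : D = ((lam.pinRPrime₁₃ (theta13OfThm1C F N ε₀ ε₂₉ B₃ a₀ a₁)).pinD189ΛH (theta13OfThm1C F N ε₀ ε₂₉ B₃ a₀ a₁).ν (theta13OfThm1C F N ε₀ ε₂₉ B₃ a₀ a₁).A₁ (theta13OfThm1C F N ε₀ ε₂₉ B₃ a₀ a₁).τ9.M (gOfRecord₁₃ F N (theta13OfThm1C F N ε₀ ε₂₉ B₃ a₀ a₁)) (fun P => (((((σ P).pinZres (theta13OfThm1C F N ε₀ ε₂₉ B₃ a₀ a₁).ν (theta13OfThm1C F N ε₀ ε₂₉ B₃ a₀ a₁).τ9.M (gOfRecord₁₃ F N (theta13OfThm1C F N ε₀ ε₂₉ B₃ a₀ a₁) P) (s P) (N0OfRecord₁₃ (theta13OfThm1C F N ε₀ ε₂₉ B₃ a₀ a₁) P (lam.kSel P + 1))).pinSides (theta13OfThm1C F N ε₀ ε₂₉ B₃ a₀ a₁).ν (gOfRecord₁₃ F N (theta13OfThm1C F N ε₀ ε₂₉ B₃ a₀ a₁) P) (lam.kSel P + 1 - Nm P) (lam.kSel P + 1)).pinXΩ4 (s P) (enlD F (theta13OfThm1C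 F N ε₀ ε₂₉ B₃ a₀ a₁).ν (theta13OfThm1C F N ε₀ ε₂₉ B₃ a₀ a₁).τ9.M P (gOfRecord₁₃ F N (theta13OfThm1C F N ε₀ ε₂₉ B₃ a₀ a₁) P))).pinOmegaPP (s P) (Nm P) (enlD F (theta13OfThm1C F N ε₀ ε₂₉ B₃ a₀ a₁).ν (theta13OfThm1C F N ε₀ ε₂₉ B₃ a₀ a₁).τ9.M P (gOfRecord₁₃ F N (theta13OfThm1C F N ε₀ ε₂₉ B₃ a₀ a₁) P)))) s Nm p₁).D189 P)
    (hmassLive : ∀ a, LiveSeq F N (theta13OfThm1C F N ε₀ ε₂₉ B₃ a₀ a₁).ν (theta13OfThm1C F N ε₀ ε₂₉ B₃ a₀ a₁).τ9 P (gOfRecord₁₃ F N (theta13OfThm1C F N ε₀ ε₂₉ B₃ a₀ a₁) P) (lam.kSel P + 1)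
        (slotsTOfRecord F N (theta13OfThm1C F N ε₀ ε₂₉ B₃ a₀ a₁).ν (theta13OfThm1C F N ε₀ ε₂₉ B₃ a₀ a₁).τ9 (EOfRecord₁₃ F N (theta13OfThm1C F N ε₀ ε₂₉ B₃ a₀ a₁)) (wOfRecord₉ F N (theta13OfThm1C F N ε₀ ε₂₉ B₃ a₀ a₁).toStage9Params)
          (theta13OfThm1C F N ε₀ ε₂₉ B₃ a₀ a₁).ppSel P (gOfRecord₁₃ F N (theta13OfThm1C F N ε₀ ε₂₉ B₃ a₀ a₁) P) (lam.kSel P + 1)) a →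
      0 < ∫ V, rterm (reprTOfRecord₁₃ F N (theta13OfThm1C F N ε₀ ε₂₉ B₃ a₀ a₁) P (lam.kSel P)) a V ∂(fieldMeasure (F.P P.K) (lam.kSel P + 1) (SU N)))
    (hP1 : Prop1Printed (lam.LF P))
    (hlog : 1 < (Real.log (gOfRecord₁₃ F N (theta13OfThm1C F N ε₀ ε₂₉ B₃ a₀ a₁) P (lam.kSel P + 1) ^ 2)⁻¹) ^ (theta13OfThm1C F N ε₀ ε₂₉ B₃ a₀ a₁).ν.r)
    (hNN : N0OfRecord₁₃ (theta13OfThm1C F N ε₀ ε₂₉ B₃ a₀ a₁) P (lam.kSel P + 1) ≤ Nm P) (hNk : N0OfRecord₁₃ (theta13OfThm1C F N ε₀ ε₂₉ B₃ a₀ a₁) P (lam.kSel P + 1) ≤ lam.kSel P + 1)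
    (hβ0 : 0 ≤ (σ P).β) (hβ : (σ P).β ≤ 1 / 4) (hL₀ : 2 ≤ (σ P).L₀) (hL₀L : (σ P).L₀ ^ 2 ≤ ((F.P P.K).L : ℝ))
    (hB : 0 ≤ (σ P).O1 * (σ P).B₃ * (σ P).B₅) (hδ : 0 ≤ (σ P).δ)
    (hN₀ : (2 + (121 / 120) ^ 2 * ((σ P).O1 * (σ P).B₃ * (σ P).B₅ * ((theta13OfThm1C F N ε₀ ε₂₉ B₃ a₀ a₁).τ9.M : ℝ) ^ 5)) *
      ((((σ P).L₀ ^ 2) ^ (N0OfRecord₁₃ (theta13OfThm1C F N ε₀ ε₂₉ B₃ a₀ a₁) P (lam.kSel P + 1) - 1))⁻¹) ≤ 1 / 4)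
    (hMl : (121 / 120) ^ 2 * ((σ P).O1 * (σ P).B₃ * (σ P).B₅ * ((theta13OfThm1C F N ε₀ ε₂₉ B₃ a₀ a₁).τ9.M : ℝ) ^ 5) * Real.exp (-(4 * (σ P).δ * ((theta13OfThm1C F N ε₀ ε₂₉ B₃ a₀ a₁).τ9.M : ℝ))) ≤ 1 / 12)
    {β₀ : ℝ} (hβ₀0 : 0 ≤ β₀) (hβ₀ : β₀ ≤ 1 / 2)
    (hflow : ∀ j, lam.kSel P + 1 - Nm P ≤ j → j < lam.kSel P + 1 → epsOfRecord (theta13OfThm1C F N ε₀ ε₂₉ B₃ a₀ a₁).ν (gOfRecord₁₃ F N (theta13OfThm1C F N ε₀ ε₂₉ B₃ a₀ a₁) P) (lam.kSel P + 1)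
      ≤ (1 + β₀) * Real.sqrt ((lam.kSel P + 1 - j : ℕ) : ℝ) * epsOfRecord (theta13OfThm1C F N ε₀ ε₂₉ B₃ a₀ a₁).ν (gOfRecord₁₃ F N (theta13OfThm1C F N ε₀ ε₂₉ B₃ a₀ a₁) P) j)
    -- NEW (this file): the window of the run up to the torus and the β-sign leaf on the window box REPLACE the coupling-step displays `hgpos hgstep hgle`
    {b γ : ℝ} (hb : 0 ≤ b) (hlow : BetaLowerH b γ (betaOfRecord₁₃ F N (theta13OfThm1C F N ε₀ ε₂₉ B₃ a₀ a₁))) (hγ1 : γ ≤ 1)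
    (hI : Step.InInterval γ P.K (gOfRecord₁₃ F N (theta13OfThm1C F N ε₀ ε₂₉ B₃ a₀ a₁) P))
    (hΛ : (((enlD F (theta13OfThm1C F N ε₀ ε₂₉ B₃ a₀ a₁).ν (theta13OfThm1C F N ε₀ ε₂₉ B₃ a₀ a₁).τ9.M P (gOfRecord₁₃ F N (theta13OfThm1C F N ε₀ ε₂₉ B₃ a₀ a₁) P)) 4 (lam.kSel P + 1 + 1 - (N0OfRecord₁₃ (theta13OfThm1C F N ε₀ ε₂₉ B₃ a₀ a₁) P (lam.kSel P + 1)))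
        (omegaOfChain (s P) (lam.kSel P + 1 + 1 - (N0OfRecord₁₃ (theta13OfThm1C F N ε₀ ε₂₉ B₃ a₀ a₁) P (lam.kSel P + 1)))))ᶜ ∩ (σ P).Z).Nonempty)
    (L91h : ∀ U, new189 D U → ∀ p ∈ plaqsOf (half D),
      Ineq191 (dist1 (plaqHol (D.Upp U) p)) (D.devV'' U p) D.α ((D.L ^ D.h)⁻¹) (D.ε D.h) (E124 D.ε D.L D.η D.k D.h))
    (L95 : ∀ U, new189 D U → ∀ p ∈ plaqsOf (half D),
      Ineq195 (D.devV'' U p) (dist1 (plaqHol (D.Uhalf U (D.boxOf p)) p)) D.α ((D.L ^ D.h)⁻¹) (D.ε D.h) (E124 D.ε D.L D.η D.k D.h))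
    (L91 : ∀ U, new189 D U → ∀ j, D.h ≤ j → j ≤ D.k → ∀ p ∈ plaqsOf (dom D j),
      Ineq191 (dist1 (plaqHol (D.Upp U) p)) (D.dev97 U p) D.α ((D.L ^ j)⁻¹) (D.ε j) (E124 D.ε D.L D.η D.k j))
    (L97 : ∀ U, new189 D U → ∀ j, D.h ≤ j → j ≤ D.k → ∀ p ∈ plaqsOf (dom D j),
      Ineq191 (D.dev97 U p) (D.dev0 U p) D.α ((D.L ^ j)⁻¹) (D.ε j) (E124 D.ε D.L D.η D.k j))
    (L80 : ∀ U, new189 D U → ∀ j, D.h ≤ j → j ≤ D.k → ∀ p ∈ plaqsOf (dom D j),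
      Ineq180 (D.dev0 U p) (D.ε D.k) D.η D.B₃ D.B₅ D.M D.δ (D.dist p) D.O1) :
    B15Leaf (WOfRecord₁₃ F N (theta13OfThm1C F N ε₀ ε₂₉ B₃ a₀ a₁)
      ((lam.pinRPrime₁₃ (theta13OfThm1C F N ε₀ ε₂₉ B₃ a₀ a₁)).pinD189ΛH (theta13OfThm1C F N ε₀ ε₂₉ B₃ a₀ a₁).ν (theta13OfThm1C F N ε₀ ε₂₉ B₃ a₀ a₁).A₁ (theta13OfThm1C F N ε₀ ε₂₉ B₃ a₀ a₁).τ9.M (gOfRecord₁₃ F N (theta13OfThm1C F N ε₀ ε₂₉ B₃ a₀ a₁))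
        (fun P => (((((σ P).pinZres (theta13OfThm1C F N ε₀ ε₂₉ B₃ a₀ a₁).ν (theta13OfThm1C F N ε₀ ε₂₉ B₃ a₀ a₁).τ9.M (gOfRecord₁₃ F N (theta13OfThm1C F N ε₀ ε₂₉ B₃ a₀ a₁) P) (s P) (N0OfRecord₁₃ (theta13OfThm1C F N ε₀ ε₂₉ B₃ a₀ a₁) P (lam.kSel P + 1))).pinSides (theta13OfThm1C F N ε₀ ε₂₉ B₃ a₀ a₁).ν (gOfRecord₁₃ F N (theta13OfThm1C F N ε₀ ε₂₉ B₃ a₀ a₁) P) (lam.kSel P + 1 - Nm P) (lam.kSel P + 1)).pinXΩ4 (s P) (enlD F (theta13OfThm1C F N ε₀ ε₂₉ B₃ a₀ a₁).ν (theta13OfThm1C F N ε₀ ε₂₉ B₃ a₀ a₁).τ9.M P (gOfRecord₁₃ F N (theta13OfThm1C F N ε₀ ε₂₉ B₃ a₀ a₁) P))).pinOmegaPP (s P) (Nm P) (enlD F (theta13OfThm1C F N ε₀ ε₂₉ B₃ a₀ a₁).ν (theta13OfThm1C F N ε₀ ε₂₉ B₃ a₀ a₁).τ9.M P (gOfRecord₁₃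 F N (theta13OfThm1C F N ε₀ ε₂₉ B₃ a₀ a₁) P)))) s Nm p₁) P) :=
  N12CouplingStepOfBetaSign.b15Leaf_WOfRecord₁₃_pinAllΛ_N0_theta13OfThm1C_of_massLive_of_flow_of_betaLowerH ε₀ ε₂₉ B₃ a₀ a₁ lam
    (fun P => (((((σ P).pinZres (theta13OfThm1C F N ε₀ ε₂₉ B₃ a₀ a₁).ν (theta13OfThm1C F N ε₀ ε₂₉ B₃ a₀ a₁).τ9.M (gOfRecord₁₃ F N (theta13OfThm1C F N ε₀ ε₂₉ B₃ a₀ a₁) P) (s P) (N0OfRecord₁₃ (theta13OfThm1C F N ε₀ ε₂₉ B₃ a₀ a₁) P (lam.kSel P + 1))).pinSides (theta13OfThm1C F N ε₀ ε₂₉ B₃ a₀ a₁).ν (gOfRecord₁₃ F N (theta13OfThm1C F N ε₀ ε₂₉ B₃ a₀ a₁) P) (lam.kSel P + 1 - Nm P) (lam.kSel P + 1)).pinXΩ4 (s P) (enlD F (theta13OfThm1C F N ε₀ ε₂₉ B₃ a₀ a₁).ν (theta13OfThm1C F N ε₀ ε₂₉ B₃ a₀ a₁).τ9.M P (gOfRecord₁₃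 F N (theta13OfThm1C F N ε₀ ε₂₉ B₃ a₀ a₁) P))).pinOmegaPP (s P) (Nm P) (enlD F (theta13OfThm1C F N ε₀ ε₂₉ B₃ a₀ a₁).ν (theta13OfThm1C F N ε₀ ε₂₉ B₃ a₀ a₁).τ9.M P (gOfRecord₁₃ F N (theta13OfThm1C F N ε₀ ε₂₉ B₃ a₀ a₁) P)))) s Nm p₁
    hB₃ ha₀ ha₁ hK
    (cubeSide_pos (F.P P.K).L_pos (show 0 < (theta13OfThm1C F N ε₀ ε₂₉ B₃ a₀ a₁).ν.M₂ from Nat.one_pos) _ _ _) -- `0 < sh`: `M₂ = 1` of record (`rfl`), module 17's `cubeSide_pos`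
    hD hmassLive hP1 hlog hNN hNk hβ0 hβ hL₀ hL₀L hB hδ hN₀ hMl hβ₀0 hβ₀ hflow hb hlow hγ1 hI hΛ L91h L95 L91 L97 L80

end Thm1CZ

section Thm1CC1Z
variable (ε₀ ε₂₉ B₃ B₃' a₀ a₁ : ℝ) (lam : ResidW F N) (σ : ∀ P : B12.RunParams, Sit189 F N P.K)
  (s : ∀ P : B12.RunParams, SeqOfRecord F (theta13OfThm1CC1 F N ε₀ ε₂₉ B₃ B₃' a₀ a₁).ν (theta13OfThm1CC1 F N ε₀ ε₂₉ B₃ B₃' a₀ a₁).τ9.M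
    (gOfRecord₁₃ F N (theta13OfThm1CC1 F N ε₀ ε₂₉ B₃ B₃' a₀ a₁) P) P.K (lam.kSel P + 1)) (Nm : B12.RunParams → ℕ) (p₁ : ℕ)

/-- **★★★ N12's ROW AT `θ₁₅ᶜᶜ¹` WITH EVERY REGION LETTER OF THE (1.89) SITUATION EXCEPT `Z` AN OBJECT OF RECORD** (12N §2's `θ₁₅ᶜᶜ¹` row at the pinned situation
family `σᶻ`; `M₂ = 1` of record discharges the cube-side sign, `M = 1` gives `0 < M`; the coupling step and the flow-input signs∕sizes from the window as in 12N §2): the kernel's list of what N12 costs per run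
at this witness — live-mass, Prop. 1 at `λ.LF P`, the levels, the base situation's residual NUMBERS + print's two p. 200 conditions, (2.8a) `hflow`, `Λ ≠ ∅`, the four ℍ-leaves + (1.80) at `D`,
the run's window + β-sign leaf + the witness letters' weak signs. [cite: Balaban1989LargeFieldI, (0.2)–(0.6) p.176, (1.2) p.178, (1.10)–(1.11) p.179, (1.73) p.192, Prop. 1 (1.78) p.194, (1.80) p.195, (1.89) p.198, pp.199–201; Balaban1988Convergent, (2.1)–(2.8) pp.254–256, (2.17) p.257; Balaban1987RG1, (0.20) p.256; Balaban1985Variational, Thm 1 p.279 (witness letters only)] -/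
theorem b15Leaf_WOfRecord₁₃_pinAllΛΩχZ_N0_theta13OfThm1CC1_of_massLive_of_flow_of_betaLowerH
    (hB₃ : 0 ≤ B₃) (hB₃' : 0 ≤ B₃') (ha₀ : 0 ≤ a₀) (ha₁ : 0 ≤ a₁) -- the witness letters' weak signs (for `0 ≤ A₀ᶜᶜ¹ ≤ A₀ᶜ ≤ 1∕16`)
    {P : B12.RunParams} (hK : lam.kSel P < P.K) 
    {D : Setting189 (F.P P.K) (SU N) (MSField (F.P P.K) (SU N) × ((j : ℕ) → VecField (F.P P.K) j (EuclideanSpace ℝ (Fin (N ^ 2 - 1))))) (Pt (F.P P.K).d)}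
    (hD : D = ((lam.pinRPrime₁₃ (theta13OfThm1CC1 F N ε₀ ε₂₉ B₃ B₃' a₀ a₁)).pinD189ΛH (theta13OfThm1CC1 F N ε₀ ε₂₉ B₃ B₃' a₀ a₁).ν (theta13OfThm1CC1 F N ε₀ ε₂₉ B₃ B₃' a₀ a₁).A₁ (theta13OfThm1CC1 F N ε₀ ε₂₉ B₃ B₃' a₀ a₁).τ9.M (gOfRecord₁₃ F N (theta13OfThm1CC1 F N ε₀ ε₂₉ B₃ B₃' a₀ a₁)) (fun P => (((((σ P).pinZres (theta13OfThm1CC1 F N ε₀ ε₂₉ B₃ B₃' a₀ a₁).ν (theta13OfThm1CC1 F N ε₀ ε₂₉ B₃ B₃' a₀ a₁).τ9.M (gOfRecord₁₃ F N (theta13OfThm1CC1 F N ε₀ ε₂₉ B₃ B₃' a₀ a₁) P) (s P) (N0OfRecord₁₃ (theta13OfThm1CC1 F N ε₀ ε₂₉ B₃ B₃' a₀ a₁) P (lam.kSel P + 1))).pinSides (theta13OfThm1CC1 F N ε₀ ε₂₉ B₃ B₃' a₀ a₁).ν (gOfRecord₁₃ F N (theta13OfThm1CC1 F N ε₀ ε₂₉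 B₃ B₃' a₀ a₁) P) (lam.kSel P + 1 - Nm P) (lam.kSel P + 1)).pinXΩ4 (s P) (enlD F (theta13OfThm1CC1 F N ε₀ ε₂₉ B₃ B₃' a₀ a₁).ν (theta13OfThm1CC1 F N ε₀ ε₂₉ B₃ B₃' a₀ a₁).τ9.M P (gOfRecord₁₃ F N (theta13OfThm1CC1 F N ε₀ ε₂₉ B₃ B₃' a₀ a₁) P))).pinOmegaPP (s P) (Nm P) (enlD F (theta13OfThm1CC1 F N ε₀ ε₂₉ B₃ B₃' a₀ a₁).ν (theta13OfThm1CC1 F N ε₀ ε₂₉ B₃ B₃' a₀ a₁).τ9.M P (gOfRecord₁₃ F N (theta13OfThm1CC1 F N ε₀ ε₂₉ B₃ B₃' a₀ a₁) P)))) s Nm p₁).D189 P)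
    (hmassLive : ∀ a, LiveSeq F N (theta13OfThm1CC1 F N ε₀ ε₂₉ B₃ B₃' a₀ a₁).ν (theta13OfThm1CC1 F N ε₀ ε₂₉ B₃ B₃' a₀ a₁).τ9 P (gOfRecord₁₃ F N (theta13OfThm1CC1 F N ε₀ ε₂₉ B₃ B₃' a₀ a₁) P) (lam.kSel P + 1)
        (slotsTOfRecord F N (theta13OfThm1CC1 F N ε₀ ε₂₉ B₃ B₃' a₀ a₁).ν (theta13OfThm1CC1 F N ε₀ ε₂₉ B₃ B₃' a₀ a₁).τ9 (EOfRecord₁₃ F N (theta13OfThm1CC1 F N ε₀ ε₂₉ B₃ B₃' a₀ a₁)) (wOfRecord₉ F N (theta13OfThm1CC1 F N ε₀ ε₂₉ B₃ B₃' a₀ a₁).toStage9Params)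
          (theta13OfThm1CC1 F N ε₀ ε₂₉ B₃ B₃' a₀ a₁).ppSel P (gOfRecord₁₃ F N (theta13OfThm1CC1 F N ε₀ ε₂₉ B₃ B₃' a₀ a₁) P) (lam.kSel P + 1)) a →
      0 < ∫ V, rterm (reprTOfRecord₁₃ F N (theta13OfThm1CC1 F N ε₀ ε₂₉ B₃ B₃' a₀ a₁) P (lam.kSel P)) a V ∂(fieldMeasure (F.P P.K) (lam.kSel P + 1) (SU N)))
    (hP1 : Prop1Printed (lam.LF P))
    (hlog : 1 < (Real.log (gOfRecord₁₃ F N (theta13OfThm1CC1 F N ε₀ ε₂₉ B₃ B₃' a₀ a₁) P (lam.kSel P + 1) ^ 2)⁻¹) ^ (theta13OfThm1CC1 F N ε₀ ε₂₉ B₃ B₃' a₀ a₁).ν.r)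
    (hNN : N0OfRecord₁₃ (theta13OfThm1CC1 F N ε₀ ε₂₉ B₃ B₃' a₀ a₁) P (lam.kSel P + 1) ≤ Nm P) (hNk : N0OfRecord₁₃ (theta13OfThm1CC1 F N ε₀ ε₂₉ B₃ B₃' a₀ a₁) P (lam.kSel P + 1) ≤ lam.kSel P + 1)
    (hβ0 : 0 ≤ (σ P).β) (hβ : (σ P).β ≤ 1 / 4) (hL₀ : 2 ≤ (σ P).L₀) (hL₀L : (σ P).L₀ ^ 2 ≤ ((F.P P.K).L : ℝ))
    (hB : 0 ≤ (σ P).O1 * (σ P).B₃ * (σ P).B₅) (hδ : 0 ≤ (σ P).δ)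
    (hN₀ : (2 + (121 / 120) ^ 2 * ((σ P).O1 * (σ P).B₃ * (σ P).B₅ * ((theta13OfThm1CC1 F N ε₀ ε₂₉ B₃ B₃' a₀ a₁).τ9.M : ℝ) ^ 5)) *
      ((((σ P).L₀ ^ 2) ^ (N0OfRecord₁₃ (theta13OfThm1CC1 F N ε₀ ε₂₉ B₃ B₃' a₀ a₁) P (lam.kSel P + 1) - 1))⁻¹) ≤ 1 / 4)
    (hMl : (121 / 120) ^ 2 * ((σ P).O1 * (σ P).B₃ * (σ P).B₅ * ((theta13OfThm1CC1 F N ε₀ ε₂₉ B₃ B₃' a₀ a₁).τ9.M : ℝ) ^ 5) * Real.exp (-(4 * (σ P).δ * ((theta13OfThm1CC1 F N ε₀ ε₂₉ B₃ B₃' a₀ a₁).τ9.M : ℝ))) ≤ 1 / 12)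
    {β₀ : ℝ} (hβ₀0 : 0 ≤ β₀) (hβ₀ : β₀ ≤ 1 / 2)
    (hflow : ∀ j, lam.kSel P + 1 - Nm P ≤ j → j < lam.kSel P + 1 → epsOfRecord (theta13OfThm1CC1 F N ε₀ ε₂₉ B₃ B₃' a₀ a₁).ν (gOfRecord₁₃ F N (theta13OfThm1CC1 F N ε₀ ε₂₉ B₃ B₃' a₀ a₁) P) (lam.kSel P + 1)
      ≤ (1 + β₀) * Real.sqrt ((lam.kSel P + 1 - j : ℕ) : ℝ) * epsOfRecord (theta13OfThm1CC1 F N ε₀ ε₂₉ B₃ B₃' a₀ a₁).ν (gOfRecord₁₃ F N (theta13OfThm1CC1 F N ε₀ ε₂₉ B₃ B₃' a₀ a₁) P) j)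
    -- NEW (this file): the window of the run up to the torus and the β-sign leaf on the window box REPLACE the coupling-step displays `hgpos hgstep hgle`
    {b γ : ℝ} (hb : 0 ≤ b) (hlow : BetaLowerH b γ (betaOfRecord₁₃ F N (theta13OfThm1CC1 F N ε₀ ε₂₉ B₃ B₃' a₀ a₁))) (hγ1 : γ ≤ 1)
    (hI : Step.InInterval γ P.K (gOfRecord₁₃ F N (theta13OfThm1CC1 F N ε₀ ε₂₉ B₃ B₃' a₀ a₁) P))
    (hΛ : (((enlD F (theta13OfThm1CC1 F N ε₀ ε₂₉ B₃ B₃' a₀ a₁).ν (theta13OfThm1CC1 F N ε₀ ε₂₉ B₃ B₃' a₀ a₁).τ9.M P (gOfRecord₁₃ F N (theta13OfThm1CC1 F N ε₀ ε₂₉ B₃ B₃' a₀ a₁) P)) 4 (lam.kSel P + 1 + 1 - (N0OfRecord₁₃ (theta13OfThm1CC1 F N ε₀ ε₂₉ B₃ B₃' a₀ a₁) P (lam.kSel P + 1)))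
        (omegaOfChain (s P) (lam.kSel P + 1 + 1 - (N0OfRecord₁₃ (theta13OfThm1CC1 F N ε₀ ε₂₉ B₃ B₃' a₀ a₁) P (lam.kSel P + 1)))))ᶜ ∩ (σ P).Z).Nonempty)
    (L91h : ∀ U, new189 D U → ∀ p ∈ plaqsOf (half D),
      Ineq191 (dist1 (plaqHol (D.Upp U) p)) (D.devV'' U p) D.α ((D.L ^ D.h)⁻¹) (D.ε D.h) (E124 D.ε D.L D.η D.k D.h))
    (L95 : ∀ U, new189 D U → ∀ p ∈ plaqsOf (half D),
      Ineq195 (D.devV'' U p) (dist1 (plaqHol (D.Uhalf U (D.boxOf p)) p)) D.α ((D.L ^ D.h)⁻¹) (D.ε D.h) (E124 D.ε D.L D.η D.k D.h))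
    (L91 : ∀ U, new189 D U → ∀ j, D.h ≤ j → j ≤ D.k → ∀ p ∈ plaqsOf (dom D j),
      Ineq191 (dist1 (plaqHol (D.Upp U) p)) (D.dev97 U p) D.α ((D.L ^ j)⁻¹) (D.ε j) (E124 D.ε D.L D.η D.k j))
    (L97 : ∀ U, new189 D U → ∀ j, D.h ≤ j → j ≤ D.k → ∀ p ∈ plaqsOf (dom D j),
      Ineq191 (D.dev97 U p) (D.dev0 U p) D.α ((D.L ^ j)⁻¹) (D.ε j) (E124 D.ε D.L D.η D.k j))
    (L80 : ∀ U, new189 D U → ∀ j, D.h ≤ j → j ≤ D.k → ∀ p ∈ plaqsOf (dom D j),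
      Ineq180 (D.dev0 U p) (D.ε D.k) D.η D.B₃ D.B₅ D.M D.δ (D.dist p) D.O1) :
    B15Leaf (WOfRecord₁₃ F N (theta13OfThm1CC1 F N ε₀ ε₂₉ B₃ B₃' a₀ a₁)
      ((lam.pinRPrime₁₃ (theta13OfThm1CC1 F N ε₀ ε₂₉ B₃ B₃' a₀ a₁)).pinD189ΛH (theta13OfThm1CC1 F N ε₀ ε₂₉ B₃ B₃' a₀ a₁).ν (theta13OfThm1CC1 F N ε₀ ε₂₉ B₃ B₃' a₀ a₁).A₁ (theta13OfThm1CC1 F N ε₀ ε₂₉ B₃ B₃' a₀ a₁).τ9.M (gOfRecord₁₃ F N (theta13OfThm1CC1 F N ε₀ ε₂₉ B₃ B₃' a₀ a₁))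
        (fun P => (((((σ P).pinZres (theta13OfThm1CC1 F N ε₀ ε₂₉ B₃ B₃' a₀ a₁).ν (theta13OfThm1CC1 F N ε₀ ε₂₉ B₃ B₃' a₀ a₁).τ9.M (gOfRecord₁₃ F N (theta13OfThm1CC1 F N ε₀ ε₂₉ B₃ B₃' a₀ a₁) P) (s P) (N0OfRecord₁₃ (theta13OfThm1CC1 F N ε₀ ε₂₉ B₃ B₃' a₀ a₁) P (lam.kSel P + 1))).pinSides (theta13OfThm1CC1 F N ε₀ ε₂₉ B₃ B₃' a₀ a₁).ν (gOfRecord₁₃ F N (theta13OfThm1CC1 F N ε₀ ε₂₉ B₃ B₃' a₀ a₁) P) (lam.kSel P + 1 - Nm P) (lam.kSel P + 1)).pinXΩ4 (s P) (enlD F (theta13OfThm1CC1 F N ε₀ ε₂₉ B₃ B₃' a₀ a₁).ν (theta13OfThm1CC1 F N ε₀ ε₂₉ B₃ B₃' a₀ a₁).τ9.M P (gOfRecord₁₃ F N (theta13OfThm1CC1 F N ε₀ ε₂₉ B₃ B₃' a₀ a₁) P))).pinOmegaPP (s P) (Nm P) (enlD F (theta13OfThm1CC1 F N ε₀ ε₂₉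 B₃ B₃' a₀ a₁).ν (theta13OfThm1CC1 F N ε₀ ε₂₉ B₃ B₃' a₀ a₁).τ9.M P (gOfRecord₁₃ F N (theta13OfThm1CC1 F N ε₀ ε₂₉ B₃ B₃' a₀ a₁) P)))) s Nm p₁) P) :=
  N12CouplingStepOfBetaSign.b15Leaf_WOfRecord₁₃_pinAllΛ_N0_theta13OfThm1CC1_of_massLive_of_flow_of_betaLowerH ε₀ ε₂₉ B₃ B₃' a₀ a₁ lam
    (fun P => (((((σ P).pinZres (theta13OfThm1CC1 F N ε₀ ε₂₉ B₃ B₃' a₀ a₁).ν (theta13OfThm1CC1 F N ε₀ ε₂₉ B₃ B₃' a₀ a₁).τ9.M (gOfRecord₁₃ F N (theta13OfThm1CC1 F N ε₀ ε₂₉ B₃ B₃' a₀ a₁) P) (s P) (N0OfRecord₁₃ (theta13OfThm1CC1 F N ε₀ ε₂₉ B₃ B₃' a₀ a₁) P (lam.kSel P + 1))).pinSides (theta13OfThm1CC1 F N ε₀ ε₂₉ B₃ B₃' a₀ a₁).ν (gOfRecord₁₃ F N (theta13OfThm1CC1 F N ε₀ ε₂₉ B₃ B₃' a₀ a₁) P)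 (lam.kSel P + 1 - Nm P) (lam.kSel P + 1)).pinXΩ4 (s P) (enlD F (theta13OfThm1CC1 F N ε₀ ε₂₉ B₃ B₃' a₀ a₁).ν (theta13OfThm1CC1 F N ε₀ ε₂₉ B₃ B₃' a₀ a₁).τ9.M P (gOfRecord₁₃ F N (theta13OfThm1CC1 F N ε₀ ε₂₉ B₃ B₃' a₀ a₁) P))).pinOmegaPP (s P) (Nm P) (enlD F (theta13OfThm1CC1 F N ε₀ ε₂₉ B₃ B₃' a₀ a₁).ν (theta13OfThm1CC1 F N ε₀ ε₂₉ B₃ B₃' a₀ a₁).τ9.M P (gOfRecord₁₃ F N (theta13OfThm1CC1 F N ε₀ ε₂₉ B₃ B₃' a₀ a₁) P)))) s Nm p₁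
    hB₃ hB₃' ha₀ ha₁ hK
    (cubeSide_pos (F.P P.K).L_pos (show 0 < (theta13OfThm1CC1 F N ε₀ ε₂₉ B₃ B₃' a₀ a₁).ν.M₂ from Nat.one_pos) _ _ _) -- `0 < sh`: `M₂ = 1` of record (`rfl`), module 17's `cubeSide_pos`
    hD hmassLive hP1 hlog hNN hNk hβ0 hβ hL₀ hL₀L hB hδ hN₀ hMl hβ₀0 hβ₀ hflow hb hlow hγ1 hI hΛ L91h L95 L91 L97 L80

end Thm1CC1Z

end Summit.QuantumFields.YangMills.BalabanUVNodes.N12AtRecord13TermPinnedZres
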